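import Literature.MathematicalPhysics.QuantumFieldTheory.Balaban1983to89.Node00.N24NodesStage13PinX3HSSepCoPH
import Literature.MathematicalPhysics.QuantumFieldTheory.Balaban1983to89.Node00.N24NodesStage13FourPinPointedCoPH
import Literature.MathematicalPhysics.QuantumFieldTheory.Balaban1983to89.Node00.Record13SClassSepCoPHG

/-!
# NODE N24 · THE FULLY GENERIC FOUR-PIN ENGINE: X-CARRIER FAMILY `X′`, [IV] CARRIER FAMILY `W₀` AND [B8] BLOCK `b8sel` ALL FREE — (B2), (B), K1⁷'s θ-KEYED CONSEQUENT and the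
# `b8`-GENERIC S-CLASS MEMBERSHIP AT A WORLD BOUND TO `(upOfRecord₅C (((((θ.rebindX X′).toStage5₁₃CoPH).pinB10).pinY (Y9OfRecord …)).pinZ (Z11OfRecord ζ)).pinW W₀) P).withB8 (b8sel P)`
# — this seat's `b8`-generic engine (`N24NodesStage13RebindXWithB8SepCoPHG`, `W := WOfRecord₁₃ (θ.rebindX X′) λW`) with seat dag-n12-d's MIXED W-PIN SLOT (`W₀` free) — so that a K1⁷ closer can
# bind N05 in ANY [B8] currency (RS ∕ repaired «P₂C» SC ∕ typed) AND N12 at a carrier family that is the bundle of record BELOW the torus and a leaf-carrying degenerate carrier OFF it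
# (dag-n12-d g16 ASK-1, bus 2026-08-28T07:45Z: on the pure pin the K1⁷ closers' N12 row keeps ONE undischargeable conjunct at the runs with `K ≤ λW.kSel P`; on the mixed pin it is a theorem)

TRACK A (YM-PLAN §2d, node N24 of 28 = binder B2), seat `pub-ymgap-dag-n24-c` (R134 fan-out seat, strategy s2; gen 10).  A NEW importing module (imports this seat's S-bound engine
`N24NodesStage13PinX3HSSepCoPH`, this seat's Co-presentation module `N24NodesStage13FourPinPointedCoPH` — whence the generic-`W₀` twin record `N24_isRecordOfRecord₁₃CCoPH_of_up_pinB10YZW₀`,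
dag-n10-d's pin faces and leaves (`upOfRecord₅C_pinW_b9_b10_b11`, `upOfRecord₅C_pinW_rBasicStep_iff`, `upOfRecord₅C_pinZ_b9∕b10∕b11_iff`, `upOfRecord₅C_pinY_b9_iff∕_b10`, `upOfRecord₅C_pinB10_b10_iff`),
node00-def's `leavesP_eq_of_up_withB8` — and dag-n05-w4's `Record13SClassSepCoPHG` p607735 (`IsRecordOfRecord₁₃CSepCoPHG`) for §3).  APPEND-ONLY; theorems only, def-free, sorry-free, standard axioms.

WHY.  Two located in-edge repairs of the K1⁷ closers of record meet in the engine: (N05) dag-n05-d's DESIGN «P₂C» — the slot every printed [B8] member serves is `B8LeafOfRecordSubBP₂C θ₃ λ₈`, bound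
at records in the repaired currency, hosted by the `b8`-GENERIC class — handled by re-binding `b8` (`b8sel` free, as in `N24NodesStage13RebindXWithB8SepCoPHG`); (N12) dag-n12-d's MIXED W-PIN
(`…N12AtTheta13OfThm1CCMWGenericDoorV19` §1∕§3, ASK-1): every N12 producer of `B15Leaf (WOfRecord₁₃ θ λW P)` needs `λW.kSel P < P.K` (def-T's step provisos are stated for `k < K`; [IV]'s 𝐑 never
visits `k ≥ K`, (0.2) p.176), so at the runs with `K ≤ λW.kSel P` (every run with `K = 0`) the pure pin's leaf has NO supplier, whereas a world pinning `W₀ P :=` the bundle of record below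
the torus and a leaf-carrying degenerate carrier elsewhere (dag-n12-d g4 `exists_printedCarriers15_b15Leaf`) needs only the GUARDED row `∀ P, λW.kSel P < P.K → B15Leaf (WOfRecord₁₃ θ λW P)`
— handled by freeing `W₀` (the generic-`W₀` chain of `N24NodesStage13FourPinPointedCoPH` §3–§4, here over `θ.rebindX X′` and `withB8`).  The S engine's proof never read either currency, so
the engine below is its bytes with the view spelled as the explicit chain: N05 ← `h05G : ∀ P, b8sel P`, N12 ← `h12W : ∀ P, B15Leaf (W₀ P)`, N01–N04 ∕ the guarded (0.20) ∕ the β-window from the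
C-BOUND TWIN WORLD `{ w with up := upOfRecord₅C (chain) }` (§0; none reads `b8` or the binding), N10 at the twin, N13's 𝐑-leaf through `withB8` (§0).  K1⁷'s TEXT reads no world: §2.

WHAT THIS FILE PROVES (6 theorems).  §0 `N24_isRecordOfRecord₁₃CCoPH_twin_of_up_withB8_rebindX_pinB10YZW₀` (the C-bound twin of the generic chain over `θ.rebindX X′` is a ₁₃CCoPH record at θ's datum; `datumOfRecord₁₃CoPH_rebindX`) ·
`N24_rOperation_iff_of_up_withB8_rebindX_pinB10YZW₀_coPH` (the 𝐑-leaf reading).  §1 ★ **`N24_nodes₁₃CoPH_rebindX_withB8_pinB10YZW₀_pointed`** (the thirteen nodes; `X′`, `W₀`, `b8sel` FREE).  §2 **`N24_endStatementBPrinted₁₃CoPH_rebindX_withB8_pinB10YZW₀_pointed`** ((B) at the datum + β-pair) ·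
**`N24_stabilityBR13SepCoPH_thetaShape20_rebindX_withB8_pinB10YZW₀_pointed`** (K1⁷'s θ-keyed consequent witnessed by `(θ, hP)`).  §3 ★ **`N24_recordG₁₃SepCoPH_of_up_withB8_rebindX_pinB10YZW₀`** (the world IS in dag-n05-w4's `b8`-GENERIC S-CLASS at θ's datum — their
`isRecordOfRecord₁₃CSepCoPHG_of_up_withB8_rebindX_view₁₃CoPHB10YZW` with the [IV] pin a free carrier family; same proof, last step through `toStage5₁₃CoPH_pin*`).  INSTANCES (not restated): `W₀ := WOfRecord₁₃ (θ.rebindX X′) λW`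
(`Stage13HParams.view₁₃CoPHB10YZW_eq`) gives `N24NodesStage13RebindXWithB8SepCoPHG`; `b8sel := B8LeafRS …` the S engine; dag-n12-d's `nodes₁₃CoPH_upS_fourPinW₀_pointed` is the case `X′ := θ.res.X`, RS.

WHICH CHILD BLOCKS K1⁷ ON THE «P₂C» + MIXED-W ROAD (kernel = §2's hypothesis list at `b8sel P := B8LeafOfRecordSubBP₂C θ₃ λ₈`, `W₀ :=` the mixed pin): K0⁷'s `hP` + guard · world bound as displayed (free
letters) · N05 `B8LeafOfRecordSubBP₂C θ₃ λ₈` (∃-currency; supplier pending the (1.5) law re-key, dag-n05-w1 p613168) · N06 ∕ N07 leaves at chosen layers · N08 PRINTED · N09 Lemma 4 at `X′ P` + Thm-3 member ·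
N10 the B13 socket · N11 (S1ᵀ) · N12 `B15Leaf (W₀ P)` (= the guarded row below the torus, dag-n12-d's `h12Fbelow_…_of_massLive` INTENT-59; a theorem off it) · N13 (R₁₃) + (UV₁₃) · β-box pair (lower half UNPRINTED, NODE O).
HONEST FRAMING: kernel bookkeeping BY NAME; NO estimate; nothing of Bałaban's asserted; every slot DISPLAYED; N05 ∕ N12 NOT discharged; N24 COMPOSITE — no discharge, no count moved (5∕27 · A 5∕28), no
stub closed; K0⁷ ∕ K1⁷ OPEN; one finite T⁴ programme at fixed ε; R4 = the conditional finite-𝕋⁴ rung `BalabanLadder.UV` only — NOT continuum ∕ ℝ⁴ ∕ OS ∕ mass gap ∕ Clay.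
-/

noncomputable section

open scoped Matrix.Norms.L2Operator

namespace Literature.MathematicalPhysics.QuantumFieldTheory.Balaban1983to89.Node00

open DagBinding T4Continuum T4DatumAssembly FlowStepRuns AveragingRT
open FlowStep (BetaLowerH BetaUpperH)
open B14NodeKnitRecord9 (b14_main_at_construction_rhoOfRecord9_along)
open B16NodeKnitRepTowerOfRecord (b16_main_at_repTowerOfRecord_along)

variable {F : T4Family} {N : ℕ} [NeZero N]

/-! ## §0. The C-bound twin record and the 𝐑-leaf reading at the generic chain over a re-bound parameter -/

/-- **THE C-BOUND TWIN WORLD OF THE GENERIC CHAIN OVER `θ.rebindX X′` IS A ₁₃CCoPH RECORD AT θ's DATUM** (this seat's `N24_isRecordOfRecord₁₃CCoPH_of_up_pinB10YZW₀` at the re-bound parameter, datum read back by dag-n10-d's `datumOfRecord₁₃CoPH_rebindX`).  N01–N04, the guarded (0.20) and the β-window transfer from it (none reads `b8` or `W`). [cite: Balaban1989LargeFieldII, Thm 1 + (0.1) pp.355–356; Balaban1988Convergent, p.244 and Thm 2 p.263; Balaban1985UV3, Thm 1 p.257; Balaban1985BackgroundPropagators, Thm 3.1 p.397; Balaban1985Variational,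 Thm 1 p.279; Balaban1989LargeFieldI, (0.2) p.176 (objects of record; bookkeeping)] -/
theorem N24_isRecordOfRecord₁₃CCoPH_twin_of_up_withB8_rebindX_pinB10YZW₀ (θ : Stage13HParams F N) (hP : θ.Provisos₁₃CoPH F N) (hθ : θ.Admissible F N)
    (X' : B12.RunParams → PrintedCarriersR) (Mstar : ℕ) (ops : OpsY N θ.toStage3Params Mstar) (ζ : ResidZ F N) (W₀ : B12.RunParams → PrintedCarriers15) (w : WorldP)
    (hC : w.C = (datumOfRecord₁₃CoPH F N θ hP).C) (hγ : 0 < w.γ ∧ w.γ ≤ θ.γ) (hL : w.L = (θ.L : ℝ)) :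
    IsRecordOfRecord₁₃CCoPH F N (datumOfRecord₁₃CoPH F N θ hP)
      { w with up := fun P => upOfRecord₅C F N ((((((θ.rebindX F N X').toStage5₁₃CoPH F N).pinB10 F N).pinY F N (Y9OfRecord N θ.toStage3Params Mstar ops)).pinZ F N (Z11OfRecord F N ζ)).pinW F N W₀) P } := by
  have hX : (θ.rebindX F N X').Provisos₁₃CoPH F N := hP.rebindX X'
  have hD : datumOfRecord₁₃CoPH F N (θ.rebindX F N X') hX = datumOfRecord₁₃CoPH F N θ hP := datumOfRecord₁₃CoPH_rebindX F N θ hP X' hX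
  rw [← hD]
  exact N24_isRecordOfRecord₁₃CCoPH_of_up_pinB10YZW₀ (θ.rebindX F N X') hX ((Stage13HParams.rebindX_admissible_iff F N θ X').2 hθ)
    Mstar ops ζ W₀ _ (hC.trans (congrArg FiniteEpsData.C hD.symm)) hγ hL (fun _ => rfl)

/-- **The pins and a `withB8` re-binding never touch the 𝐑-carrier** (generic chain): `(leavesP w P).rOperation ↔ ∀ k < K, TLaw₁₃CoPH θ P k → SLaw₁₃CoPH θ P (k+1)` (`Iff.rfl` to `ROpLeaf (VOfRecord₁₃CoPH (θ.rebindX X′) P)`, node00-def-T's `rOpLeaf_VOfRecord₁₃CoPH_iff`; the laws at the re-bound parameter ARE θ's). [cite: Balaban1989LargeFieldII, Thm 1 + (0.1) pp.355–356; Balaban1988Convergent, p.244 and Thm 2 p.263; Balaban1985UV3, Thm 1 p.257; Balaban1985BackgroundPropagators, Thm 3.1 p.397; Balaban1985Variational, Thm 1 p.279; Balaban1989LargeFieldI, (0.2) p.176 (objects of record; bookkeeping)] -/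
theorem N24_rOperation_iff_of_up_withB8_rebindX_pinB10YZW₀_coPH (θ : Stage13HParams F N) (X' : B12.RunParams → PrintedCarriersR) (Mstar : ℕ) (ops : OpsY N θ.toStage3Params Mstar)
    (ζ : ResidZ F N) (W₀ : B12.RunParams → PrintedCarriers15) {b : Prop} {w : WorldP} {P : B12.RunParams}
    (hup : w.up P = (upOfRecord₅C F N ((((((θ.rebindX F N X').toStage5₁₃CoPH F N).pinB10 F N).pinY F N (Y9OfRecord N θ.toStage3Params Mstar ops)).pinZ F N (Z11OfRecord F N ζ)).pinW F N W₀) P).withB8 b) :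
    (leavesP w P).rOperation ↔ ∀ k, k < P.K → TLaw₁₃CoPH F N θ P k → SLaw₁₃CoPH F N θ P (k + 1) := by
  have hV : (leavesP w P).rOperation ↔ ROpLeaf (VOfRecord₁₃CoPH F N (θ.rebindX F N X') P) := by
    show (w.up P).rOperation ↔ _
    rw [hup]
    exact Iff.rfl
  exact hV.trans (rOpLeaf_VOfRecord₁₃CoPH_iff F N (θ.rebindX F N X') P)

/-! ## §1. The thirteen nodes at a world bound to the generic four-pin chain over `θ.rebindX X'` with `W₀` free and the `b8` block re-bound — N05 ← `b8sel P`, N12 ← `B15Leaf (W₀ P)` -/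

/-- **★ N24 · THE THIRTEEN DAG NODES AT A WORLD BOUND TO `(upOfRecord₅C (generic four-pin chain over θ.rebindX X′, [IV] family W₀) P).withB8 (b8sel P)`** (Core-keyed; `X′`, `W₀`, `b8sel` FREE):
**N05 ← `h05G : ∀ P, b8sel P`**; N06 `B9LeafX (Y9OfRecord …)`; N07 `B11Leaf (Z11OfRecord F N ζ)`; N08 `PrintedUV3V N θ.L`; N09 own leaf at `X' P` + Theorem-3 member `h09T`; N10 B13 socket at `X' P` (at the
C-bound twin; `Dag.B13_main` reads `b9 b10 b11 b12 b13` only); N11 (S1ᵀ) `h11`; **N12 `h12W : ∀ P, B15Leaf (W₀ P)`** (seat dag-n12-d's mixed-pin slot); N13 (R₁₃) `hR` + (UV₁₃) `hUV`; N01 ∕ N02 ∕ N04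
node00-def-T's transferred theorems and N03 at the C-bound twin (§0), transported by `leavesP_eq_of_up_withB8`; the Y ∕ B10 ∕ Z ∕ W leaves by dag-n10-d's pin faces.  Proof = this seat's
`N24_nodes₁₃B10YZW₀_pointed_coPH` at `θ.rebindX X′` with the `b8` block re-bound. [cite: Balaban1989LargeFieldII, Thm 1 p.355, (0.1) pp.355–356, p.387, p.391; Balaban1985RegularSpaces, Lemma 1 – Thm 8 pp.79–101, Prop. 7 (1.145) p.100, Thm 8 (1.146) p.101 (the `b8` block, any currency); Balaban1985UV3, Thm 1 p.257 + Thm 2 p.272; Balaban1985BackgroundPropagators, Thm 3.1 p.397; Balaban1985Variational, Thm 1 p.279 + Thm 3 p.278; Balaban1988Convergent, Thm 1 p.262, Thm 2 p.263, p.244; Balaban1987RG1, Lemma 4 p.291, Thm 3 p.264; Balaban1988RG2Cluster, Lemmas 1–3 pp.9–20; Balaban1989LargeFieldI, (0.2)–(0.6) p.176 (the [IV] carrier family, free; bookkeeping)] -/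
theorem N24_nodes₁₃CoPH_rebindX_withB8_pinB10YZW₀_pointed (θ : Stage13HParams F N) (hP : θ.Provisos₁₃CoPH F N) (hθ : θ.Admissible F N)
    (X' : B12.RunParams → PrintedCarriersR) (Mstar : ℕ) (ops : OpsY N θ.toStage3Params Mstar) (ζ : ResidZ F N)
    (W₀ : B12.RunParams → PrintedCarriers15) (b8sel : B12.RunParams → Prop) (w : WorldP)
    (hC : w.C = (datumOfRecord₁₃CoPH F N θ hP).C) (hγ : 0 < w.γ ∧ w.γ ≤ θ.γ) (hL : w.L = (θ.L : ℝ))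
    (hup : ∀ P, w.up P = (upOfRecord₅C F N ((((((θ.rebindX F N X').toStage5₁₃CoPH F N).pinB10 F N).pinY F N (Y9OfRecord N θ.toStage3Params Mstar ops)).pinZ F N (Z11OfRecord F N ζ)).pinW F N W₀) P).withB8 (b8sel P))
    (h05G : ∀ P : B12.RunParams, b8sel P)
    (h06 : B9LeafX (Y9OfRecord N θ.toStage3Params Mstar ops))
    (h07 : B11Leaf (Z11OfRecord F N ζ))
    (h08 : PrintedUV3V N θ.L)
    (h09 : ∀ P : B12.RunParams, B12Sec2to5.Lemma4Printed (X' P).F12 (X' P).c12)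
    (h09T : ∀ P : B12.RunParams, (leavesP w P).smallCouplings → (leavesP w P).smallFieldInductive)
    (h10 : ∀ P : B12.RunParams, B9LeafX (Y9OfRecord N θ.toStage3Params Mstar ops) →
      (B10.Thm1PrintedCompact (((((((θ.rebindX F N X').toStage5₁₃CoPH F N).pinB10 F N).pinY F N (Y9OfRecord N θ.toStage3Params Mstar ops)).pinZ F N (Z11OfRecord F N ζ)).pinW F N W₀).res.X P).runs10 ∧
          B10.Thm2Printed (((((((θ.rebindX F N X').toStage5₁₃CoPH F N).pinB10 F N).pinY F N (Y9OfRecord N θ.toStage3Params Mstar ops)).pinZ F N (Z11OfRecord F N ζ)).pinW F N W₀).res.X P).runs10) →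
        B11Leaf (Z11OfRecord F N ζ) → B12Sec2to5.Lemma4Printed (X' P).F12 (X' P).c12 →
          B13.Lemma1Printed (X' P).S13 (X' P).c13 ∧ B13.Lemma2Printed (X' P).S13 (X' P).c13 ∧
            B13.Lemma3Printed (X' P).S13 (X' P).c13)
    (h11 : ∀ P : B12.RunParams, (leavesP w P).b7 → (leavesP w P).b8 → (leavesP w P).b9 → (leavesP w P).b10 → (leavesP w P).b11 →
      (leavesP w P).smallCouplings → (leavesP w P).smallFieldInductive → (leavesP w P).flowControl →
        ∀ k, k < P.K → SLaw₁₃CoPH F N θ P k → TLaw₁₃CoPH F N θ P k)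
    (h12W : ∀ P : B12.RunParams, B15Leaf (W₀ P))
    (hR : ∀ (P : B12.RunParams) (k : ℕ), k < P.K → TLaw₁₃CoPH F N θ P k → SLaw₁₃CoPH F N θ P (k + 1))
    (hUV : ∀ P : B12.RunParams, (genFlow (betaOfRecord₁₃ F N θ.toStage13Params) P.g0).InInterval w.γ P.K → ∀ k, k ≤ P.K → SLaw₁₃CoPH F N θ P k →
      ∀ U : GaugeField (F.P P.K) k (SU N),
        chiβOfRecord₁₃ F N θ.toStage13Params P.K (gOfRecord₁₃ F N θ.toStage13Params P) k U *
              Real.exp (-(1 / (gOfRecord₁₃ F N θ.toStage13Params P k) ^ 2 * wilsonBGOfRecord F N θ.εbg P k U)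
                - w.em (gOfRecord₁₃ F N θ.toStage13Params P k) * (Fintype.card (Site (F.P P.K) k) : ℝ)) ≤ densOfRecord₁₃ F N θ.toStage13Params P k U ∧
        densOfRecord₁₃ F N θ.toStage13Params P k U ≤ Real.exp (w.ep (gOfRecord₁₃ F N θ.toStage13Params P k) * (Fintype.card (Site (F.P P.K) k) : ℝ))) :
    ∀ P : B12.RunParams, Nodes (leavesP w P) := by
  intro P
  have hrec' := N24_isRecordOfRecord₁₃CCoPH_twin_of_up_withB8_rebindX_pinB10YZW₀ θ hP hθ X' Mstar ops ζ W₀ w hC hγ hL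
  have hleaves := leavesP_eq_of_up_withB8 hup P
  have h4 : Dag.B4_main (leavesP w P) := by rw [hleaves]; exact b4_main_of_isRecordOfRecord₁₃CCoPH hrec' P
  have h5 : Dag.B5_main (leavesP w P) := by rw [hleaves]; exact b5_main_of_isRecordOfRecord₁₃CCoPH hrec' P
  have h6 : Dag.B6_main (leavesP w P) := by rw [hleaves]; exact N24_b6_main_of_isRecordOfRecord₁₃CCoPH hrec' P
  have h7 : Dag.B7_main (leavesP w P) := by rw [hleaves]; exact b7_main_of_isRecordOfRecord₁₃CCoPH hrec' P
  have hw := upOfRecord₅C_pinW_b9_b10_b11 F N (((((θ.rebindX F N X').toStage5₁₃CoPH F N).pinB10 F N).pinY F N (Y9OfRecord N θ.toStage3Params Mstar ops)).pinZ F N (Z11OfRecord F N ζ)) W₀ P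
  have hl : ((upOfRecord₅C F N ((((((θ.rebindX F N X').toStage5₁₃CoPH F N).pinB10 F N).pinY F N (Y9OfRecord N θ.toStage3Params Mstar ops)).pinZ F N (Z11OfRecord F N ζ)).pinW F N W₀) P).rBasicStep ↔ B15Leaf (W₀ P)) ∧
      ((upOfRecord₅C F N ((((((θ.rebindX F N X').toStage5₁₃CoPH F N).pinB10 F N).pinY F N (Y9OfRecord N θ.toStage3Params Mstar ops)).pinZ F N (Z11OfRecord F N ζ)).pinW F N W₀) P).b9 ↔ B9LeafX (Y9OfRecord N θ.toStage3Params Mstar ops)) ∧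
      ((upOfRecord₅C F N ((((((θ.rebindX F N X').toStage5₁₃CoPH F N).pinB10 F N).pinY F N (Y9OfRecord N θ.toStage3Params Mstar ops)).pinZ F N (Z11OfRecord F N ζ)).pinW F N W₀) P).b10 ↔ PrintedUV3V N θ.L) ∧
      ((upOfRecord₅C F N ((((((θ.rebindX F N X').toStage5₁₃CoPH F N).pinB10 F N).pinY F N (Y9OfRecord N θ.toStage3Params Mstar ops)).pinZ F N (Z11OfRecord F N ζ)).pinW F N W₀) P).b11 ↔ B11Leaf (Z11OfRecord F N ζ)) := by
    refine ⟨upOfRecord₅C_pinW_rBasicStep_iff F N _ _ P, ?_, ?_, ?_⟩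
    · rw [hw.1, upOfRecord₅C_pinZ_b9]
      exact upOfRecord₅C_pinY_b9_iff F N _ _ P
    · rw [hw.2.1, upOfRecord₅C_pinZ_b10, upOfRecord₅C_pinY_b10]
      exact upOfRecord₅C_pinB10_b10_iff F N ((θ.rebindX F N X').toStage5₁₃CoPH F N) P
    · rw [hw.2.2]
      exact upOfRecord₅C_pinZ_b11_iff F N _ _ P
  have h8 : (w.up P).b8 := by rw [hup P]; exact h05G P
  have h9 : (w.up P).b9 := by rw [hup P]; exact hl.2.1.2 h06
  have h10leaf : (w.up P).b10 := by rw [hup P]; exact hl.2.2.1.2 h08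
  have h11leaf : (w.up P).b11 := by rw [hup P]; exact hl.2.2.2.2 h07
  have h15 : (w.up P).rBasicStep := by rw [hup P]; exact hl.1.2 (h12W P)
  have h12leaf : (leavesP w P).b12 := by
    show (w.up P).b12
    rw [hup P]; exact h09 P
  have h13 : Dag.B13_main (leavesP w P) := by
    have h' : Dag.B13_main (leavesP { w with up := fun P => upOfRecord₅C F N ((((((θ.rebindX F N X').toStage5₁₃CoPH F N).pinB10 F N).pinY F N (Y9OfRecord N θ.toStage3Params Mstar ops)).pinZ F N (Z11OfRecord F N ζ)).pinW F N W₀) P } P) :=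
      B13NodeKnitRecord5C.b13_main_at_stage5ParamsC F N ((((((θ.rebindX F N X').toStage5₁₃CoPH F N).pinB10 F N).pinY F N (Y9OfRecord N θ.toStage3Params Mstar ops)).pinZ F N (Z11OfRecord F N ζ)).pinW F N W₀) _ P rfl (h10 P)
    show (w.up P).b9 → (w.up P).b10 → (w.up P).b11 → (w.up P).b12 → (w.up P).b13
    rw [hup P]
    exact h'
  have hrop := N24_rOperation_iff_of_up_withB8_rebindX_pinB10YZW₀_coPH θ X' Mstar ops ζ W₀ (hup P)
  exact ⟨h4, h5, h6, h7, B8LeafKnit.b8_main_of_leaf w P h8, fun _ _ _ _ => h9, fun _ _ _ _ _ _ => h10leaf,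
    fun _ _ _ _ _ => h11leaf, B12NodeKnitRecord8.b12_main_of_leaf_of_thm3Member h12leaf (h09T P), h13,
    b14_main_at_construction_rhoOfRecord9_along F N (coreOfRecord₁₃CoPH F N θ) w P θ.ν θ.τ9 (EOfRecord₁₃ F N θ.toStage13Params) (wOfRecord₉ F N θ.toStage9Params) θ.ppSel
      (gOfRecord₁₃ F N θ.toStage13Params) (fun p k _ => SLaw₁₃CoPH F N θ p k) (fun p k _ => TLaw₁₃CoPH F N θ p k) (hC.trans (datumOfRecord₁₃CoPH_C F N θ hP))
      (fun _ _ => Iff.rfl) (fun _ => sLaw₁₃CoPH_zero F N θ P) (h11 P) (fun hr => hrop.1 hr),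
    B15LeafKnit.b15_main_of_up (U := w.up P) rfl h15,
    b16_main_at_repTowerOfRecord_along F N (coreOfRecord₁₃CoPH F N θ) w P θ.ν θ.τ9 (EOfRecord₁₃ F N θ.toStage13Params) (wOfRecord₉ F N θ.toStage9Params) θ.ppSel
      (gOfRecord₁₃ F N θ.toStage13Params) (fun k _ => SLaw₁₃CoPH F N θ P k) (fun k _ => TLaw₁₃CoPH F N θ P k) (hC.trans (datumOfRecord₁₃CoPH_C F N θ hP))
      (fun _ _ => Iff.rfl) hrop.2 (hR P) le_rfl (hUV P)⟩

/-! ## §2. (B) at the datum and item K1⁷'s θ-keyed consequent, at such a world -/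

/-- **N24 · (B2) AT `(datumOfRecord₁₃CoPH θ hP).C` FROM THE POINTED CHILDREN AT THE GENERIC CHAIN** (Core-keyed): node00-def-T's headline `endStatementBPrinted_of_nodesP_interval_guarded` AT THE BOUND
WORLD (no record predicate reads the binding) — nodes by §1, the guarded (0.20) and the β-window from the C-bound twin record (§0; both read `w.C`, `w.γ` only). [cite: Balaban1989LargeFieldII, Thm 1 p.355 + p.391; Balaban1987RG1, (0.20) p.256, (1.22) p.264; Balaban1985RegularSpaces, Thm 8 (1.146) p.101 (bookkeeping + elementary window)] -/
theorem N24_endStatementBPrinted₁₃CoPH_rebindX_withB8_pinB10YZW₀_pointed (θ : Stage13HParams F N) (hP : θ.Provisos₁₃CoPH F N) (hθ : θ.Admissible F N)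
    (X' : B12.RunParams → PrintedCarriersR) (Mstar : ℕ) (ops : OpsY N θ.toStage3Params Mstar) (ζ : ResidZ F N)
    (W₀ : B12.RunParams → PrintedCarriers15) (b8sel : B12.RunParams → Prop) (w : WorldP)
    (hC : w.C = (datumOfRecord₁₃CoPH F N θ hP).C) (hγ : 0 < w.γ ∧ w.γ ≤ θ.γ) (hL : w.L = (θ.L : ℝ))
    (hup : ∀ P, w.up P = (upOfRecord₅C F N ((((((θ.rebindX F N X').toStage5₁₃CoPH F N).pinB10 F N).pinY F N (Y9OfRecord N θ.toStage3Params Mstar ops)).pinZ F N (Z11OfRecord F N ζ)).pinW F N W₀) P).withB8 (b8sel P))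
    (h05G : ∀ P : B12.RunParams, b8sel P)
    (h06 : B9LeafX (Y9OfRecord N θ.toStage3Params Mstar ops))
    (h07 : B11Leaf (Z11OfRecord F N ζ))
    (h08 : PrintedUV3V N θ.L)
    (h09 : ∀ P : B12.RunParams, B12Sec2to5.Lemma4Printed (X' P).F12 (X' P).c12)
    (h09T : ∀ P : B12.RunParams, (leavesP w P).smallCouplings → (leavesP w P).smallFieldInductive)
    (h10 : ∀ P : B12.RunParams, B9LeafX (Y9OfRecord N θ.toStage3Params Mstar ops) →
      (B10.Thm1PrintedCompact (((((((θ.rebindX F N X').toStage5₁₃CoPH F N).pinB10 F N).pinY F N (Y9OfRecord N θ.toStage3Params Mstar ops)).pinZ F N (Z11OfRecord F N ζ)).pinW F N W₀).res.X P).runs10 ∧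
          B10.Thm2Printed (((((((θ.rebindX F N X').toStage5₁₃CoPH F N).pinB10 F N).pinY F N (Y9OfRecord N θ.toStage3Params Mstar ops)).pinZ F N (Z11OfRecord F N ζ)).pinW F N W₀).res.X P).runs10) →
        B11Leaf (Z11OfRecord F N ζ) → B12Sec2to5.Lemma4Printed (X' P).F12 (X' P).c12 →
          B13.Lemma1Printed (X' P).S13 (X' P).c13 ∧ B13.Lemma2Printed (X' P).S13 (X' P).c13 ∧
            B13.Lemma3Printed (X' P).S13 (X' P).c13)
    (h11 : ∀ P : B12.RunParams, (leavesP w P).b7 → (leavesP w P).b8 → (leavesP w P).b9 → (leavesP w P).b10 → (leavesP w P).b11 →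
      (leavesP w P).smallCouplings → (leavesP w P).smallFieldInductive → (leavesP w P).flowControl →
        ∀ k, k < P.K → SLaw₁₃CoPH F N θ P k → TLaw₁₃CoPH F N θ P k)
    (h12W : ∀ P : B12.RunParams, B15Leaf (W₀ P))
    (hR : ∀ (P : B12.RunParams) (k : ℕ), k < P.K → TLaw₁₃CoPH F N θ P k → SLaw₁₃CoPH F N θ P (k + 1))
    (hUV : ∀ P : B12.RunParams, (genFlow (betaOfRecord₁₃ F N θ.toStage13Params) P.g0).InInterval w.γ P.K → ∀ k, k ≤ P.K → SLaw₁₃CoPH F N θ P k →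
      ∀ U : GaugeField (F.P P.K) k (SU N),
        chiβOfRecord₁₃ F N θ.toStage13Params P.K (gOfRecord₁₃ F N θ.toStage13Params P) k U *
              Real.exp (-(1 / (gOfRecord₁₃ F N θ.toStage13Params P k) ^ 2 * wilsonBGOfRecord F N θ.εbg P k U)
                - w.em (gOfRecord₁₃ F N θ.toStage13Params P k) * (Fintype.card (Site (F.P P.K) k) : ℝ)) ≤ densOfRecord₁₃ F N θ.toStage13Params P k U ∧
        densOfRecord₁₃ F N θ.toStage13Params P k U ≤ Real.exp (w.ep (gOfRecord₁₃ F N θ.toStage13Params P k) * (Fintype.card (Site (F.P P.K) k) : ℝ))) 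
    (hlo : BetaLowerH w.b w.γ (datumOfRecord₁₃CoPH F N θ hP).βfun) (hhi : BetaUpperH w.βup w.γ (datumOfRecord₁₃CoPH F N θ hP).βfun) :
    B16.EndStatementBPrinted (datumOfRecord₁₃CoPH F N θ hP).C := by
  have hrec' := N24_isRecordOfRecord₁₃CCoPH_twin_of_up_withB8_rebindX_pinB10YZW₀ θ hP hθ X' Mstar ops ζ W₀ w hC hγ hL
  have hn := N24_nodes₁₃CoPH_rebindX_withB8_pinB10YZW₀_pointed θ hP hθ X' Mstar ops ζ W₀ b8sel w hC hγ hL hup h05G h06 h07 h08 h09 h09T h10 h11 h12W hR hUV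
  rw [← hC]
  exact endStatementBPrinted_of_nodesP_interval_guarded w hγ.1 le_rfl hn (fun P hsc => rgFlow_of_smallCouplings_of_isRecordOfRecord₁₃CCoPH hrec' P hsc)
    (N24_betaBoundsInInterval_of_isRecordOfRecord₁₃CCoPH_of_boxH hrec' hlo hhi)

/-- **★ ITEM K1⁷ (stmt-QuantumFields-20542)'s θ-KEYED CONSEQUENT, WITNESSED BY `(θ, hP)`, FROM THE POINTED CHILDREN AT THE GENERIC CHAIN** — guard `hU` displayed; (B) by the previous theorem at
`hP.toCore`, window by module 26's `N24_window_of_betaUpperH`.  COMPOSITE: nothing is discharged; the item's TEXT reads no world, hence neither the `b8` currency nor the [IV] pin. [cite: Balaban1989LargeFieldII, Thm 1 p.355, (0.1) pp.355–356, p.391; Balaban1985RegularSpaces, Prop. 7 (1.145) p.100, Thm 8 (1.146) p.101; Balaban1987RG1, Thm 3 p.264, (0.17)–(0.20) pp.255–256 and (1.22) p.264; Balaban1985UV3, Thm 1 p.257 (bookkeeping + elementary window)] -/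
theorem N24_stabilityBR13SepCoPH_thetaShape20_rebindX_withB8_pinB10YZW₀_pointed (θ : Stage13HParams F N) (hP : θ.Provisos₁₃SepCoPH F N) (hθ : θ.Admissible F N)
    (hU : θ.ZhUnity F N ∧ θ.SlotsNondegenerate₁₃ F N)
    (X' : B12.RunParams → PrintedCarriersR) (Mstar : ℕ) (ops : OpsY N θ.toStage3Params Mstar) (ζ : ResidZ F N)
    (W₀ : B12.RunParams → PrintedCarriers15) (b8sel : B12.RunParams → Prop) (w : WorldP)
    (hC : w.C = (datumOfRecord₁₃SepCoPH F N θ hP).C) (hγ : 0 < w.γ ∧ w.γ ≤ θ.γ) (hL : w.L = (θ.L : ℝ))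
    (hup : ∀ P, w.up P = (upOfRecord₅C F N ((((((θ.rebindX F N X').toStage5₁₃CoPH F N).pinB10 F N).pinY F N (Y9OfRecord N θ.toStage3Params Mstar ops)).pinZ F N (Z11OfRecord F N ζ)).pinW F N W₀) P).withB8 (b8sel P))
    (h05G : ∀ P : B12.RunParams, b8sel P)
    (h06 : B9LeafX (Y9OfRecord N θ.toStage3Params Mstar ops))
    (h07 : B11Leaf (Z11OfRecord F N ζ))
    (h08 : PrintedUV3V N θ.L)
    (h09 : ∀ P : B12.RunParams, B12Sec2to5.Lemma4Printed (X' P).F12 (X' P).c12)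
    (h09T : ∀ P : B12.RunParams, (leavesP w P).smallCouplings → (leavesP w P).smallFieldInductive)
    (h10 : ∀ P : B12.RunParams, B9LeafX (Y9OfRecord N θ.toStage3Params Mstar ops) →
      (B10.Thm1PrintedCompact (((((((θ.rebindX F N X').toStage5₁₃CoPH F N).pinB10 F N).pinY F N (Y9OfRecord N θ.toStage3Params Mstar ops)).pinZ F N (Z11OfRecord F N ζ)).pinW F N W₀).res.X P).runs10 ∧
          B10.Thm2Printed (((((((θ.rebindX F N X').toStage5₁₃CoPH F N).pinB10 F N).pinY F N (Y9OfRecord N θ.toStage3Params Mstar ops)).pinZ F N (Z11OfRecord F N ζ)).pinW F N W₀).res.X P).runs10) →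
        B11Leaf (Z11OfRecord F N ζ) → B12Sec2to5.Lemma4Printed (X' P).F12 (X' P).c12 →
          B13.Lemma1Printed (X' P).S13 (X' P).c13 ∧ B13.Lemma2Printed (X' P).S13 (X' P).c13 ∧
            B13.Lemma3Printed (X' P).S13 (X' P).c13)
    (h11 : ∀ P : B12.RunParams, (leavesP w P).b7 → (leavesP w P).b8 → (leavesP w P).b9 → (leavesP w P).b10 → (leavesP w P).b11 →
      (leavesP w P).smallCouplings → (leavesP w P).smallFieldInductive → (leavesP w P).flowControl →
        ∀ k, k < P.K → SLaw₁₃CoPH F N θ P k → TLaw₁₃CoPH F N θ P k)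
    (h12W : ∀ P : B12.RunParams, B15Leaf (W₀ P))
    (hR : ∀ (P : B12.RunParams) (k : ℕ), k < P.K → TLaw₁₃CoPH F N θ P k → SLaw₁₃CoPH F N θ P (k + 1))
    (hUV : ∀ P : B12.RunParams, (genFlow (betaOfRecord₁₃ F N θ.toStage13Params) P.g0).InInterval w.γ P.K → ∀ k, k ≤ P.K → SLaw₁₃CoPH F N θ P k →
      ∀ U : GaugeField (F.P P.K) k (SU N),
        chiβOfRecord₁₃ F N θ.toStage13Params P.K (gOfRecord₁₃ F N θ.toStage13Params P) k U *
              Real.exp (-(1 / (gOfRecord₁₃ F N θ.toStage13Params P k) ^ 2 * wilsonBGOfRecord F N θ.εbg P k U)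
                - w.em (gOfRecord₁₃ F N θ.toStage13Params P k) * (Fintype.card (Site (F.P P.K) k) : ℝ)) ≤ densOfRecord₁₃ F N θ.toStage13Params P k U ∧
        densOfRecord₁₃ F N θ.toStage13Params P k U ≤ Real.exp (w.ep (gOfRecord₁₃ F N θ.toStage13Params P k) * (Fintype.card (Site (F.P P.K) k) : ℝ))) 
    (hlo : BetaLowerH w.b w.γ (datumOfRecord₁₃SepCoPH F N θ hP).βfun) (hhi : BetaUpperH w.βup w.γ (datumOfRecord₁₃SepCoPH F N θ hP).βfun) :
    ∃ (θ' : Stage13HParams F N) (h' : θ'.Provisos₁₃SepCoPH F N), (θ'.ZhUnity F N ∧ θ'.SlotsNondegenerate₁₃ F N) ∧ θ'.Admissible F N ∧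
      B16.EndStatementBPrinted (datumOfRecord₁₃SepCoPH F N θ' h').C ∧
      ∃ γ₁ : ℝ, 0 < γ₁ ∧ ∀ γ : ℝ, 0 < γ → γ ≤ γ₁ → ∃ P : B12.RunParams, 1 ≤ P.K ∧ ((datumOfRecord₁₃SepCoPH F N θ' h').C P).flow.InInterval γ P.K :=
  ⟨θ, hP, hU, hθ, N24_endStatementBPrinted₁₃CoPH_rebindX_withB8_pinB10YZW₀_pointed θ hP.toCore hθ X' Mstar ops ζ W₀ b8sel w hC hγ hL hup h05G h06 h07 h08 h09 h09T h10 h11 h12W hR hUV hlo hhi,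
    N24_window_of_betaUpperH _ hγ.1 hhi⟩

/-! ## §3. The world IS in dag-n05-w4's `b8`-generic S-class at θ's datum (their four-pin hosting with the [IV] pin a free carrier family) -/

/-- **★ G-CLASS HOSTING AT THE GENERIC CHAIN** (`X′`, `W₀`, `b8sel` FREE): a world with `w.C = (datumOfRecord₁₃SepCoPH θ h).C`, `0 < w.γ ≤ θ.γ`, `w.L = θ.L`,
`w.up P = (upOfRecord₅C (((((θ.rebindX X′).toStage5₁₃CoPH).pinB10).pinY (Y9OfRecord …)).pinZ (Z11OfRecord ζ)).pinW W₀) P).withB8 (b8sel P)` IS in `IsRecordOfRecord₁₃CSepCoPHG` AT θ's DATUM — presenting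
parameter the quintuply pinned `((((θ.rebindX X′).pinB10).pinY …).pinZ …).pinW W₀` exactly as in dag-n05-w4's `isRecordOfRecord₁₃CSepCoPHG_of_up_withB8_rebindX_view₁₃CoPHB10YZW` (p607735; proof ported with
`WOfRecord₁₃ … λW ↦ W₀`, last step through dag-n10-d's `toStage5₁₃CoPH_pin*`). [cite: Balaban1989LargeFieldII, Thm 1 + (0.1) pp.355–356; Balaban1988Convergent, p.244 and Thm 2 p.263; Balaban1985UV3, Thm 1 p.257; Balaban1985BackgroundPropagators, Thm 3.1 p.397; Balaban1985Variational, Thm 1 p.279; Balaban1989LargeFieldI, (0.2) p.176 (objects of record; bookkeeping)] -/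
theorem N24_recordG₁₃SepCoPH_of_up_withB8_rebindX_pinB10YZW₀ (θ : Stage13HParams F N) (hP : θ.Provisos₁₃SepCoPH F N) (hθ : θ.Admissible F N)
    (X' : B12.RunParams → PrintedCarriersR) (Mstar : ℕ) (ops : OpsY N θ.toStage3Params Mstar) (ζ : ResidZ F N) (W₀ : B12.RunParams → PrintedCarriers15)
    (b8sel : B12.RunParams → Prop) (w : WorldP)
    (hC : w.C = (datumOfRecord₁₃SepCoPH F N θ hP).C) (hγ : 0 < w.γ ∧ w.γ ≤ θ.γ) (hL : w.L = (θ.L : ℝ))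
    (hup : ∀ P, w.up P = (upOfRecord₅C F N ((((((θ.rebindX F N X').toStage5₁₃CoPH F N).pinB10 F N).pinY F N (Y9OfRecord N θ.toStage3Params Mstar ops)).pinZ F N (Z11OfRecord F N ζ)).pinW F N W₀) P).withB8 (b8sel P)) :
    IsRecordOfRecord₁₃CSepCoPHG F N (datumOfRecord₁₃SepCoPH F N θ hP) w := by
  have hX : (θ.rebindX F N X').Provisos₁₃SepCoPH F N := hP.rebindX X'
  have hD := datumOfRecord₁₃SepCoPH_rebindX F N θ hP X' hX
  rw [← hD] at hC ⊢
  have hθ' : (θ.rebindX F N X').Admissible F N := (Stage13HParams.rebindX_admissible_iff F N θ X').2 hθ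
  have hA1 : ((θ.rebindX F N X').pinB10 F N).Admissible F N := (Stage13Params.pinB10_admissible_iff F N (θ.rebindX F N X').toStage13Params).2 hθ'
  have hA2 : (((θ.rebindX F N X').pinB10 F N).pinY F N (Y9OfRecord N θ.toStage3Params Mstar ops)).Admissible F N :=
    (Stage13Params.pinY_admissible_iff F N ((θ.rebindX F N X').pinB10 F N).toStage13Params (Y9OfRecord N θ.toStage3Params Mstar ops)).2 hA1
  have hA3 : ((((θ.rebindX F N X').pinB10 F N).pinY F N (Y9OfRecord N θ.toStage3Params Mstar ops)).pinZ F N (Z11OfRecord F N ζ)).Admissible F N :=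
    (Stage13Params.pinZ_admissible_iff F N (((θ.rebindX F N X').pinB10 F N).pinY F N (Y9OfRecord N θ.toStage3Params Mstar ops)).toStage13Params (Z11OfRecord F N ζ)).2 hA2
  have hA4 : (((((θ.rebindX F N X').pinB10 F N).pinY F N (Y9OfRecord N θ.toStage3Params Mstar ops)).pinZ F N (Z11OfRecord F N ζ)).pinW F N W₀).Admissible F N :=
    (Stage13Params.pinW_admissible_iff F N ((((θ.rebindX F N X').pinB10 F N).pinY F N (Y9OfRecord N θ.toStage3Params Mstar ops)).pinZ F N (Z11OfRecord F N ζ)).toStage13Params W₀).2 hA3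
  refine ⟨((((θ.rebindX F N X').pinB10 F N).pinY F N (Y9OfRecord N θ.toStage3Params Mstar ops)).pinZ F N (Z11OfRecord F N ζ)).pinW F N W₀,
    ((hX.pinB10.pinY (Y9OfRecord N θ.toStage3Params Mstar ops)).pinZ (Z11OfRecord F N ζ)).pinW W₀, b8sel, hA4, ?_, hC, hγ, hL, fun P => ?_⟩
  · exact ((datumOfRecord₁₃SepCoPH_pinB10 F N (θ.rebindX F N X') hX).symm.trans
      ((datumOfRecord₁₃SepCoPH_pinY F N ((θ.rebindX F N X').pinB10 F N) hX.pinB10 (Y9OfRecord N θ.toStage3Params Mstar ops)).symm.trans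
        ((datumOfRecord₁₃SepCoPH_pinZ F N _ (hX.pinB10.pinY (Y9OfRecord N θ.toStage3Params Mstar ops)) (Z11OfRecord F N ζ)).symm.trans
          (datumOfRecord₁₃SepCoPH_pinW F N _ ((hX.pinB10.pinY (Y9OfRecord N θ.toStage3Params Mstar ops)).pinZ (Z11OfRecord F N ζ)) W₀).symm)))
  · rw [hup P, Stage13HParams.toStage5₁₃CoPH_pinW, Stage13HParams.toStage5₁₃CoPH_pinZ, Stage13HParams.toStage5₁₃CoPH_pinY, Stage13HParams.toStage5₁₃CoPH_pinB10]

end Literature.MathematicalPhysics.QuantumFieldTheory.Balaban1983to89.Node00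

end
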